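import Literature.NumberTheory.DiophantineGeometry.GenEllRemarks44
import Literature.NumberTheory.DiophantineGeometry.GenEllFullGalois
import HarnessLib

/-!
# [GenEll] Remark 4.4.2: exceptional sets pull back along the Legendre classifying map
# (in the exceptional-set vocabulary of `GenEllFullGalois`)

Proof-only sequel of `GenEllRemarks44.lean` (S. Mochizuki, *Arithmetic elliptic curves in general
position*, Math. J. Okayama Univ. **52** (2010) [cite: MochizukiGenEll2010], Rmk. 4.4.2 p. 24: "one
obtains a result entirely similar to Corollary 4.4 by replacing `M_ell ⊆ M̄_ell` by `U_P ⊆ P`").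
Cor. 4.4 / Thm. 3.8 / Lem. 3.7 carry a "Galois-finite exceptional set `Exc ⊆ M_ell(Q̄)`", which
`GenEllFullGalois.lean` (abc-iut-S4) presents INVARIANTLY as a set of minimal polynomials of
`j`-invariants (`MellExcMem Exc P :↔ minpoly ℚ j(P) ∈ Exc`, `MellExcGaloisFinite Exc :↔` finitely many
members in each degree).  Here: the preimage of such an `Exc` under the classifying map
`λ ↦ E_λ` of `GenEllRemarks44` is a Galois-finite subset of `U_P(Q̄)` in the sense of
`GenEllNorthcott` (`IsGaloisFinite`: finitely many minimal polynomials of `λ` in each degree) —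
`NFPoint.isGaloisFinite_legendre_preimage_exc` — so that the `U_P`-version of Cor. 4.4 asserted by
Rmk. 4.4.2 can quantify over "`[E_λ] ∉ Exc`" with S4's `Exc` verbatim.  Everything is proved;
classical; no side is taken on anything disputed.
-/

noncomputable section

namespace Literature.NumberTheory.DiophantineGeometry.GenEll

namespace NFPoint

/-- The points of `M_ell(Q̄)^{≤ d}` lying in an exceptional set `Exc` (a set of minimal polynomials of
`j`) with finitely many members of each degree form a set with finitely many points: the minimal
polynomial of `j(E)` over `ℚ` has degree `≤ [F : ℚ] ≤ d` for `E` presented over `F`.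
[cite: MochizukiGenEll2010, Rmk 4.4.2 p.24] -/
theorem mellHasFinitelyManyPoints_exc_inter_mellLe {Exc : Set (Polynomial ℚ)}
    (hExc : MellExcGaloisFinite Exc) (d : ℕ) :
    MellHasFinitelyManyPoints ({P : EllPoint | MellExcMem Exc P} ∩ MellLe d) := by
  refine (hExc d).subset ?_
  rintro _ ⟨P, ⟨hPexc, hPd⟩, rfl⟩
  refine ⟨hPexc, ?_⟩
  -- `deg (minpoly ℚ j) ≤ [F : ℚ] ≤ d`
  calc (minpoly ℚ P.W.j).natDegree ≤ Module.finrank ℚ P.F := minpoly.natDegree_le P.W.j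
    _ ≤ d := hPd

/-- **Rmk. 4.4.2, bookkeeping of the exceptional set**: for a Galois-finite exceptional set
`Exc ⊆ M_ell(Q̄)` in the invariant presentation of `GenEllFullGalois` (`MellExcGaloisFinite Exc`), the
set of points `λ ∈ U_P(Q̄)` whose Legendre curve `E_λ` lies in `Exc` is Galois-finite in `U_P(Q̄)`
(`IsGaloisFinite`, [GenEll] Ex. 1.3 (i)). [cite: MochizukiGenEll2010, Rmk 4.4.2 p.24] -/
theorem isGaloisFinite_legendre_preimage_exc {Exc : Set (Polynomial ℚ)} (hExc : MellExcGaloisFinite Exc) :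
    IsGaloisFinite {Q : NFPoint | ∃ hQ : Q.InU, MellExcMem Exc (Q.legendre hQ)} :=
  isGaloisFinite_legendre_preimage (M := {P : EllPoint | MellExcMem Exc P})
    fun d => mellHasFinitelyManyPoints_exc_inter_mellLe hExc d

end NFPoint

end Literature.NumberTheory.DiophantineGeometry.GenEll

end
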